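import Summits.BirchSwinnertonDyer.BirchSwinnertonDyer.Theorems.AdditiveBranchIMCGreenbergVatsalResidualBranchOfPrint
import Literature.NumberTheory.EllipticCurves.GreenbergVatsal2000.EisensteinCongruenceTwistedOdd
import Literature.NumberTheory.EllipticCurves.Rank1Residual.GVParityTwistProofs
import Literature.NumberTheory.EllipticCurves.QuadraticTwistMinimalModelProofs
import Literature.NumberTheory.EllipticCurves.QuadraticTwistIntegralModel
import Literature.NumberTheory.DiophantineGeometry.MinimalDiscriminantProofs
import Literature.NumberTheory.DiophantineGeometry.MinimalDiscriminantSmulProofs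
import HarnessLib

/-!
# The READING `thm312_branch_…` on its ODD-sign half `p ≡ 3 (mod 4)` is a KERNEL CONSEQUENCE of
# GV Thm. (3.12) at the odd `χ = (·/p)` (typed: `thm312_quadraticTwistOdd_…`) + the two character
# sentences of pp. 41–42 at a twist (route K1 `AdditiveBranchIMC`, crux ReadingFacts, child **19297**
# `GreenbergVatsalResidualBranch` — supports only; seat `bsd-inputs-abimc-rf-p1`)

HONEST FRAMING (cell `bsd-addord`, `run/shared/lean/pub/bsd-addord/README.md` §4): KERNEL GLUE between
named facts of the tree; THEOREMS ONLY (no `def`, no `sorry`); nothing is booked; BSD is not proved by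
any of this. Sequel of `AdditiveBranchIMCGreenbergVatsalResidualBranchOfPrint.lean` (the even-sign
half from Thm. (3.11), p627805); together they give the reading hGV =
`thm312_branch_unitContent_and_lambda_eq_residual_goodOrd` (item 19297) from FOUR verbatim-er typed
GV statements (`…OfPrintFull.lean`).

## What

* §1 `hasGoodReductionAt_of_smul_quadraticTwist_neg_of_mod_four_eq_three`,
  `hasGoodReductionAt_of_quadraticTwist_neg_smul_eq_of_mod_four_eq_three` — good reduction off `p`
  passes between `W` and its twist model `C • V^{(−p)} = W`, `p ≡ 3 (mod 4)` (integral twist model with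
  `k = −(p+1)/4`, `4k + 1 = −p`; Silverman VII.1.3, as in `…GoodReduction.lean` for `+p`).
* §2 **`thm312_branch_of_thm312TwistedOdd_of_characterFacts_of_mod_four_eq_three`** — T312odd ∧ C ∧ D
  ⟹ hGV's conclusion for every instance of hGV's hypotheses with `p ≡ 3 (mod 4)`. Along the twist by
  `−p` complex conjugation NEGATES `√−p`, so the even line `Φ₀ ≤ W[p]` of the reading transports to an
  ODD ramified line of `V[p]` — exactly Thm. (3.12)'s parity hypothesis `χ(−1) = −ψ(−1)` at the odd
  `χ` (cell audit `D-AUDIT-19361-stub_gvBranch.md` R1: "odd = admissible"); everything else is the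
  even half's glue verbatim (Gauss-sum sign, Kronecker–Weber characters, presentations, `ord_T`).

References: [GreenbergVatsal2000] §2 pp. 28–29, §3 Thm. (3.12), (24), (26)–(28), Lemma (3.6), Prop. (3.1);
[SilvermanAEC2009] VII.1 Prop. 1.3, X.5 Cor. 5.4; [IrelandRosen1990] Ch. 6 Prop. 6.3.2.
-/

set_option autoImplicit false
set_option linter.dupNamespace false

noncomputable section

open scoped Classical MatrixGroups ModularForm

namespace Summit.BirchSwinnertonDyer.BirchSwinnertonDyer.Theorems.AdditiveBranchIMCGreenbergVatsalResidualBranchOfPrintOdd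

open NumberField IsDedekindDomain Field WeierstrassCurve CongruenceSubgroup PowerSeries
  Literature.NumberTheory.EllipticCurves Literature.NumberTheory.GaloisRepresentations
  Literature.NumberTheory.EllipticCurves.ModularForms
  Literature.NumberTheory.EllipticCurves.Rank1Residual
  Literature.NumberTheory.EllipticCurves.GreenbergVatsal2000
  Literature.NumberTheory.DiophantineGeometry
  Summit.BirchSwinnertonDyer.Rank1Residual.Additive
  Summit.BirchSwinnertonDyer.Rank1Residual.X2.ResidualDevissageLine
  Summit.BirchSwinnertonDyer.Rank1Residual.X2.ResidualLineCharacters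
  Summit.BirchSwinnertonDyer.BirchSwinnertonDyer.Theorems.AdditiveBranchIMCCharacterLFunctionPresentation
  Summit.BirchSwinnertonDyer.BirchSwinnertonDyer.Theorems.AdditiveBranchIMCGreenbergVatsalResidualBranchTransport
  Summit.BirchSwinnertonDyer.BirchSwinnertonDyer.Theorems.AdditiveBranchIMCGreenbergVatsalResidualBranchCharacters
  Summit.BirchSwinnertonDyer.BirchSwinnertonDyer.Theorems.AdditiveBranchIMCGreenbergVatsalResidualBranchOfPrint

/-! ### §0 Small tools -/

section Tools

variable {p : ℕ} [hp : Fact p.Prime]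

/-- `θ² = −p` has no rational solution. [folklore] -/
theorem not_mem_range_algebraMap_of_sq_eq_neg_prime {K : Type} [Field K] [CharZero K] {θ : K}
    (hθ : θ ^ 2 = algebraMap ℚ K (-(p : ℚ))) : θ ∉ Set.range (algebraMap ℚ K) := by
  rintro ⟨q, rfl⟩
  rw [← map_pow] at hθ
  have hq : q ^ 2 = -(p : ℚ) := (algebraMap ℚ K).injective hθ
  have hp0 : (0 : ℚ) < p := by exact_mod_cast hp.out.pos
  nlinarith [sq_nonneg q]

end Tools

/-! ### §1 Good reduction off `p` along the twist by `−p`, `p ≡ 3 (mod 4)` -/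

section GoodReduction

variable {p : ℕ}

/-- **Good reduction at `v ∤ p` passes from `W` to a model `V` of `W^{(−p)}`, `p ≡ 3 (mod 4)`** (the
twist is unramified at every `v ∤ p`, including `v ∣ 2`, since `−p ≡ 1 (mod 4)`; integral twist model
with `4k + 1 = −p`). [cite: SilvermanAEC2009, VII.1 Prop. 1.3 and VII.5 Prop. 5.1(a)] -/
theorem hasGoodReductionAt_of_smul_quadraticTwist_neg_of_mod_four_eq_three
    (W V : WeierstrassCurve ℚ) [W.IsElliptic] [V.IsElliptic] (hp4 : p % 4 = 3)
    {C : VariableChange ℚ} (hC : C • W.quadraticTwist (-(p : ℚ)) = V)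
    (v : HeightOneSpectrum (𝓞 ℚ)) (hpv : ((p : ℕ) : 𝓞 ℚ) ∉ v.asIdeal)
    (hW : W.HasGoodReductionAt v) : V.HasGoodReductionAt v := by
  -- the twisting parameter `k = −(p+1)/4 ∈ ℤ`, `4k + 1 = −p`
  set k : ℚ := -((((p + 1) / 4 : ℕ)) : ℚ) with hk
  have hk4 : 4 * k + 1 = -(p : ℚ) := by
    rw [hk]
    have h : 4 * ((p + 1) / 4) = p + 1 := by omega
    have h' : (4 : ℚ) * (((p + 1) / 4 : ℕ) : ℚ) = (p : ℚ) + 1 := by exact_mod_cast h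
    linarith
  have hvk : v.valuation ℚ k ≤ 1 := by
    rw [hk, show (-((((p + 1) / 4 : ℕ)) : ℚ)) =
      algebraMap (𝓞 ℚ) ℚ (-(((p + 1) / 4 : ℕ) : 𝓞 ℚ)) by rw [map_neg, map_natCast]]
    exact HeightOneSpectrum.valuation_le_one v _
  have hvd : v.valuation ℚ (4 * k + 1) = 1 := by
    rw [hk4, Valuation.map_neg,
      show ((p : ℚ)) = algebraMap (𝓞 ℚ) ℚ ((p : ℕ) : 𝓞 ℚ) by rw [map_natCast],
      HeightOneSpectrum.valuation_of_algebraMap]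
    exact le_antisymm (HeightOneSpectrum.intValuation_le_one v _)
      (not_lt.mp fun h ↦ hpv ((HeightOneSpectrum.intValuation_lt_one_iff_mem v _).mp h))
  obtain ⟨C', -, hC'⟩ := W.exists_variableChange_twistModel_eq_quadraticTwist k
  rw [hk4] at hC'
  have hV : V = (C * C') • W.twistModel k := by rw [mul_smul, hC', hC]
  have hord : V.ordMinimalDiscriminant v = W.ordMinimalDiscriminant v := by
    rw [hV, ordMinimalDiscriminant_smul_holds v (W.twistModel k) (C * C'),
      ordMinimalDiscriminant_twistModel v W hvk hvd]
  have h0 : W.ordMinimalDiscriminant v = 0 := (ordMinimalDiscriminant_eq_zero_iff_holds v W).mpr hW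
  exact (ordMinimalDiscriminant_eq_zero_iff_holds v V).mp (by rw [hord, h0])

/-- **The `V`-side good-reduction hypothesis of `thm312_quadraticTwistOdd_…` from the `W`-side one of
the reading** (`C • V^{(−p)} = W`, `p ≡ 3 (mod 4)`; twist involution + the previous theorem).
[cite: SilvermanAEC2009, VII.5 Prop. 5.1(a) and X.5 Cor. 5.4] -/
theorem hasGoodReductionAt_of_quadraticTwist_neg_smul_eq_of_mod_four_eq_three [hp : Fact p.Prime]
    (V W : WeierstrassCurve ℚ) [V.IsElliptic] [W.IsElliptic] (hp4 : p % 4 = 3)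
    {C : VariableChange ℚ} (hC : C • V.quadraticTwist (-(p : ℚ)) = W)
    {S₀ : Finset (HeightOneSpectrum (𝓞 ℚ))}
    (hS : ∀ v : HeightOneSpectrum (𝓞 ℚ), v ∉ S₀ → ((p : ℕ) : 𝓞 ℚ) ∉ v.asIdeal →
      W.HasGoodReductionAt v) :
    ∀ v : HeightOneSpectrum (𝓞 ℚ), v ∉ S₀ → ((p : ℕ) : 𝓞 ℚ) ∉ v.asIdeal →
      V.HasGoodReductionAt v := by
  intro v hv hpv
  have hp0 : (-(p : ℚ)) ≠ 0 := neg_ne_zero.mpr (by exact_mod_cast hp.out.ne_zero)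
  obtain ⟨C', hC'⟩ := exists_variableChange_twist_of_model_twist V hp0 hC
  exact hasGoodReductionAt_of_smul_quadraticTwist_neg_of_mod_four_eq_three W V hp4 hC' v hpv
    (hS v hv hpv)

end GoodReduction

/-! ### §2 The odd-sign half of the reading from T312odd ∧ C ∧ D -/

/-- **GV Thm. (3.12) on the `ω^{(p−1)/2}`-branch (the reading hGV, item 19297) for `p ≡ 3 (mod 4)`,
FROM the typed Thm. (3.12) at the odd `χ = (·/p)` and the two twisted character facts.** For every
instance of the hypotheses of `thm312_branch_unitContent_and_lambda_eq_residual_goodOrd` with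
`p ≡ 3 (mod 4)`: `b·∏_{ℓ∈Σ₀}𝒫_ℓ(W)` has unit content and
`p^{ord_T(b∏𝒫 mod p)} = #H¹(ℚ_Σ/ℚ_∞, Φ₀)·#U(W[p]/Φ₀)`. Same glue as the even half
(`…OfPrint.lean`), along the twist by `p* = −p`: complex conjugation negates `√−p`, so the even line
`Φ₀ ≤ W[p]` goes to an ODD ramified line of `V[p]` (the parity hypothesis of Thm. (3.12) at the odd
`χ`), and the twist is still unramified off `p` (`−p ≡ 1 (mod 4)`).
[cite: GreenbergVatsal2000, §3 Thm. (3.12) p. 45, (24) p. 39, (26)–(28) pp. 41–43, Lemma (3.6) pp. 37–38; §2 pp. 28–29] -/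
theorem thm312_branch_of_thm312TwistedOdd_of_characterFacts_of_mod_four_eq_three
    (h312 : thm312_quadraticTwistOdd_hasUnitContent_iff_and_order_eq_of_lineRamifiedOdd)
    (hCfact : characterLFunctionC_hasUnitContent_and_order_eq_card_of_ne_one)
    (hDfact : characterLFunctionD_hasUnitContent_and_order_eq_card_of_ne_teichmuller)
    (V : WeierstrassCurve ℚ) [V.IsGloballyMinimal] [V.IsElliptic]
    (W : WeierstrassCurve ℚ) [W.IsGloballyMinimal] [W.IsElliptic] (p : ℕ) [hp : Fact p.Prime]
    (K : Type) [Field K] [NumberField K] [(galRange (K := ℚ) K).Normal]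
    (κ : ZpExtension ℚ p) {N : ℕ} [NeZero N] (f : CuspForm (Gamma0 N) 2)
    (S₀ : Finset (HeightOneSpectrum (𝓞 ℚ)))
    (Φ₀ : AddSubgroup (W.geomTorsion (p : ℤ))) (hΦ : IsRationalLine W p Φ₀)
    (hp2 : p ≠ 2) (hp4 : p % 4 = 3) (hgood : V.HasGoodReductionAtPrime p)
    (hord : ¬ (p : ℤ) ∣ V.frobeniusTrace p) (_hred : ¬ V.HasIrreducibleModPGaloisRep p)
    (h2 : Module.finrank ℚ K = 2) (hθ : ∃ θ : K, θ ^ 2 = algebraMap ℚ K ((-1) ^ (p / 2) * p))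
    (hCW : ∃ C : VariableChange ℚ, C • V.quadraticTwist ((-1) ^ (p / 2) * p : ℚ) = W)
    (hκ : κ.IsCyclotomic) (hf : IsNewformOf V f) (heven : LineEven W p Φ₀)
    (hnt : ∃ (σ : absoluteGaloisGroup ℚ) (P : W.geomTorsion (p : ℤ)), P ∈ Φ₀ ∧ σ • P ≠ P)
    (hram : ¬ ∀ v : HeightOneSpectrum (𝓞 ℚ), ((p : ℕ) : 𝓞 ℚ) ∈ v.asIdeal →
        ∀ 𝔓 ∈ v.primesAbove, ∀ σ ∈ 𝔓.inertia (absoluteGaloisGroup ℚ), ∀ P ∈ Φ₀,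
          σ • P = (if σ ∈ galRange (K := ℚ) K then P else -P))
    (hS₀ : ∀ v ∈ S₀, ((p : ℕ) : 𝓞 ℚ) ∉ v.asIdeal)
    (hS : ∀ v : HeightOneSpectrum (𝓞 ℚ), v ∉ S₀ → ((p : ℕ) : 𝓞 ℚ) ∉ v.asIdeal →
      W.HasGoodReductionAt v)
    (ϖ : ℚ) (hϖ : if Even (p / 2) then (ϖ : ℝ) * V.realPeriodRat = plusPeriod f
        else (ϖ : ℝ) * V.imaginaryPeriodRat = minusPeriod f)
    (b : IwasawaAlgebra p) (u : ℤ_[p]ˣ)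
    (hb : iwasawaToPowerSeries p b =
        PowerSeries.C ((((u : ℤ_[p]) : ℚ_[p])) * ((ϖ : ℚ) : ℚ_[p])) *
          (if Even (p / 2) then padicLFunctionBranch f ((unitRoot V p : ℤ_[p]) : ℚ_[p]) (p / 2)
            else padicLFunctionMinusBranch f ((unitRoot V p : ℤ_[p]) : ℚ_[p]) (p / 2))) :
    HasUnitContent (b * eulerFactorProduct W p S₀) ∧
      p ^ (PowerSeries.map (PadicInt.toZMod (p := p)) (b * eulerFactorProduct W p S₀)).order.toNat =
        Nat.card (residualLineH1 W p κ S₀ Φ₀ hΦ) * Nat.card (residualQuotSelmer W p κ S₀ Φ₀ hΦ) := by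
  have hpr : p.Prime := hp.out
  -- parity of `(p−1)/2` and `p* = −p`
  have hodd2 : ¬ Even (p / 2) := Nat.not_even_iff_odd.mpr (Nat.odd_iff.mpr (by omega))
  rw [if_neg hodd2] at hϖ hb
  have hd : ((-1 : ℚ) ^ (p / 2) * p) = -(p : ℚ) := by
    rw [(Nat.not_even_iff_odd.mp hodd2).neg_one_pow, neg_one_mul]
  -- the twist model and the sign-equivariant `e : W[p] ≃ V[p]`
  obtain ⟨C, hC⟩ := hCW
  rw [hd] at hC
  have hC' : C⁻¹ • W = V.quadraticTwist (-(p : ℚ)) := by rw [← hC, inv_smul_smul]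
  have hSV : ∀ v : HeightOneSpectrum (𝓞 ℚ), v ∉ S₀ → ((p : ℕ) : 𝓞 ℚ) ∉ v.asIdeal →
      V.HasGoodReductionAt v :=
    hasGoodReductionAt_of_quadraticTwist_neg_smul_eq_of_mod_four_eq_three V W hp4 hC hS
  have hp0 : (-(p : ℚ)) ≠ 0 := neg_ne_zero.mpr (by exact_mod_cast hpr.ne_zero)
  have hpneg : (-(p : ℚ)) < 0 := neg_lt_zero.mpr (by exact_mod_cast hpr.pos)
  obtain ⟨e, hpos, hneg⟩ := exists_signEquiv_of_twist (W := V) (Wd := W) (p := p) hp0 C⁻¹ hC'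
  set ε : absoluteGaloisGroup ℚ → Prop :=
    fun σ ↦ σ • geomSqrt (-(p : ℚ)) = geomSqrt (-(p : ℚ)) with hε
  -- the transported line datum on `V`
  set Φ₁ : AddSubgroup (V.geomTorsion (p : ℤ)) := Φ₀.map e.toAddMonoidHom with hΦ₁
  have hΦ₁r : IsRationalLine V p Φ₁ := isRationalLine_map_signEquiv e ε hpos hneg hΦ
  have hodd₁ : LineOdd V p Φ₁ :=
    (lineOdd_map_signEquiv_iff_of_neg e ε hneg (fun c hc h ↦ geomSqrt_ne_neg hp0
      (h.symm.trans (smul_geomSqrt_eq_neg_of_isComplexConjugation hpneg hc))) Φ₀).mpr heven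
  obtain ⟨θ, hθ⟩ := hθ
  rw [hd] at hθ
  have hθK : θ ∉ Set.range (algebraMap ℚ K) := not_mem_range_algebraMap_of_sq_eq_neg_prime hθ
  have hKε : ∀ σ : absoluteGaloisGroup ℚ, σ ∈ galRange (K := ℚ) K ↔ ε σ := fun σ ↦
    mem_galRange_iff_smul_geomSqrt_eq K h2 hθK hθ σ
  have hram₁ : ¬ LineUnramifiedAt V p Φ₁ := by
    intro hunr
    apply hram
    intro v hv 𝔓 h𝔓 σ hσ P hP
    have h1 := (lineUnramifiedAt_map_iff_forall_smul_eq_ite e ε hpos hneg Φ₀).mp hunr v hv 𝔓 h𝔓 σ hσ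
      P hP
    by_cases hσK : σ ∈ galRange (K := ℚ) K
    · rw [if_pos hσK]; rwa [if_pos ((hKε σ).mp hσK)] at h1
    · rw [if_neg hσK]; rwa [if_neg (fun h ↦ hσK ((hKε σ).mpr h))] at h1
  -- the characters of `Φ₁` and `V[p]/Φ₁` (Kronecker–Weber)
  obtain ⟨m, hm, φ, hφprim, -, hφ0⟩ := exists_character_sub hΦ₁r
  obtain ⟨d, hdne, ψ, hψprim, -, hψ0⟩ := exists_character_quot hΦ₁r
  -- the sign is the Legendre symbol of `χ_p`
  have hsgn : ∀ σ : absoluteGaloisGroup ℚ, (if ε σ then (1 : ℤ) else -1) =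
      quadraticChar (ZMod p) ((modNCyclotomicCharacter ℚ p σ : (ZMod p)ˣ) : ZMod p) := by
    intro σ
    have h := ite_smul_geomSqrt_pStar_eq_quadraticChar hp2 σ
    rwa [hd] at h
  -- the product presentations of T311χ and their primitive characters
  set χq : DirichletCharacter (ZMod p) p :=
    (quadraticChar (ZMod p)).ringHomComp (Int.castRingHom (ZMod p)) with hχq
  set φ' : DirichletCharacter (ZMod p) (p * m) :=
    DirichletCharacter.changeLevel (dvd_mul_right p m) χq *
      DirichletCharacter.changeLevel (dvd_mul_left m p) φ with hφ'
  set ψ' : DirichletCharacter (ZMod p) (d * p) :=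
    DirichletCharacter.changeLevel (dvd_mul_right d p) ψ *
      DirichletCharacter.changeLevel (dvd_mul_left p d) χq with hψ'
  haveI : NeZero (p * m) := ⟨mul_ne_zero hpr.ne_zero (NeZero.ne m)⟩
  haveI : NeZero (d * p) := ⟨mul_ne_zero (NeZero.ne d) hpr.ne_zero⟩
  haveI : NeZero φ'.conductor := ⟨φ'.conductor_ne_zero⟩
  haveI : NeZero ψ'.conductor := ⟨ψ'.conductor_ne_zero⟩
  have hχqval : ∀ σ : absoluteGaloisGroup ℚ,
      χq ((modNCyclotomicCharacter ℚ p σ : (ZMod p)ˣ) : ZMod p) =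
        ((if ε σ then (1 : ℤ) else -1 : ℤ) : ZMod p) := by
    intro σ
    rw [hsgn σ, hχq, MulChar.ringHomComp_apply]
    rfl
  -- (F1) the character of `Φ₀ ≤ W[p]` is `θ_C = φ'.primitiveCharacter`
  have hθC0 : ∀ (σ : absoluteGaloisGroup ℚ), ∀ P ∈ Φ₀,
      σ • P = (φ'.primitiveCharacter ((modNCyclotomicCharacter ℚ φ'.conductor σ :
        (ZMod φ'.conductor)ˣ) : ZMod φ'.conductor)).val • P := by
    intro σ P hP
    set n : ℕ := (φ ((modNCyclotomicCharacter ℚ m σ : (ZMod m)ˣ) : ZMod m)).val with hn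
    have h1 : σ • P = (if ε σ then (n : ℤ) else -(n : ℤ)) • P :=
      smul_eq_ite_zsmul_of_forall_map e ε hpos hneg
        (fun Q hQ ↦ by rw [hφ0 σ Q hQ, ← hn, natCast_zsmul]) hP
    rw [h1, ← natCast_zsmul]
    refine zsmul_eq_zsmul_of_intCast_eq ?_ P
    have hite : (if ε σ then (n : ℤ) else -(n : ℤ)) = (if ε σ then (1 : ℤ) else -1) * n := by
      split_ifs <;> ring
    rw [Int.cast_natCast, ZMod.natCast_zmod_val, primitiveCharacter_apply_modN,
      mul_changeLevel_apply_modN, hite, Int.cast_mul, ← hχqval σ, Int.cast_natCast, hn,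
      ZMod.natCast_zmod_val]
  have hθCA : ∀ (σ : absoluteGaloisGroup ℚ) (x : (lineSub Φ₀ hΦ).Sub),
      σ • x = (φ'.primitiveCharacter ((modNCyclotomicCharacter ℚ φ'.conductor σ :
        (ZMod φ'.conductor)ˣ) : ZMod φ'.conductor)).val • x :=
    fun σ x ↦ X3Branch.smul_sub_eq_of_forall_mem hΦ (hθC0 σ) x
  -- (F2) the character of `W[p]/Φ₀` is `θ_D = ψ'.primitiveCharacter`
  have hθD0 : ∀ (σ : absoluteGaloisGroup ℚ) (P : W.geomTorsion (p : ℤ)),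
      σ • P - (ψ'.primitiveCharacter ((modNCyclotomicCharacter ℚ ψ'.conductor σ :
        (ZMod ψ'.conductor)ˣ) : ZMod ψ'.conductor)).val • P ∈ Φ₀ := by
    intro σ P
    set n : ℕ := (ψ ((modNCyclotomicCharacter ℚ d σ : (ZMod d)ˣ) : ZMod d)).val with hn
    have h1 : σ • P - (if ε σ then (n : ℤ) else -(n : ℤ)) • P ∈ Φ₀ :=
      smul_sub_ite_zsmul_mem_of_forall_map e ε hpos hneg
        (fun Q ↦ by have h := hψ0 σ Q; rwa [← hn, ← natCast_zsmul] at h) P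
    have h2 : (ψ'.primitiveCharacter ((modNCyclotomicCharacter ℚ ψ'.conductor σ :
        (ZMod ψ'.conductor)ˣ) : ZMod ψ'.conductor)).val • P =
        (if ε σ then (n : ℤ) else -(n : ℤ)) • P := by
      rw [← natCast_zsmul]
      refine zsmul_eq_zsmul_of_intCast_eq ?_ P
      have hite : (if ε σ then (n : ℤ) else -(n : ℤ)) = (n : ℤ) * (if ε σ then (1 : ℤ) else -1) := by
        split_ifs <;> ring
      rw [Int.cast_natCast, ZMod.natCast_zmod_val, primitiveCharacter_apply_modN,
        mul_changeLevel_apply_modN, hite, Int.cast_mul, ← hχqval σ, Int.cast_natCast, hn,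
        ZMod.natCast_zmod_val]
    rwa [h2]
  have hθDQ : ∀ (σ : absoluteGaloisGroup ℚ) (y : (lineSub Φ₀ hΦ).Quot),
      σ • y = (ψ'.primitiveCharacter ((modNCyclotomicCharacter ℚ ψ'.conductor σ :
        (ZMod ψ'.conductor)ˣ) : ZMod ψ'.conductor)).val • y :=
    fun σ y ↦ smul_quot_eq_of_forall_mem hΦ (hθD0 σ) y
  -- primitivity, parity, non-triviality, conductor support
  have hθCprim := DirichletCharacter.primitiveCharacter_isPrimitive φ'
  have hθDprim := DirichletCharacter.primitiveCharacter_isPrimitive ψ'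
  have hθCeven : φ'.primitiveCharacter.Even := even_of_lineEven hΦ heven hθCA
  have hθDodd : ψ'.primitiveCharacter.Odd := odd_of_lineEven hΦ hp2 heven hθDQ
  have hθC1 : φ'.primitiveCharacter ≠ 1 := X3Branch.character_sub_ne_one_of_exists_smul_ne hnt hθC0
  have hθDω := X3Branch.exists_coprime_apply_ne_of_exists_smul_ne hΦ hnt hθC0 hθD0
  have hSm : ∀ ℓ : ℕ, ℓ.Prime → ℓ ∣ φ'.conductor → ℓ ≠ p →
      ∃ v ∈ S₀, ((ℓ : ℕ) : 𝓞 ℚ) ∈ v.asIdeal :=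
    fun ℓ hℓ hℓm hℓp ↦ exists_mem_of_dvd_level_sub hΦ hS hθCprim hθCA hℓ hℓm hℓp
  have hSd : ∀ ℓ : ℕ, ℓ.Prime → ℓ ∣ ψ'.conductor → ℓ ≠ p →
      ∃ v ∈ S₀, ((ℓ : ℕ) : 𝓞 ℚ) ∈ v.asIdeal :=
    fun ℓ hℓ hℓd hℓp ↦ X3Branch.exists_mem_of_dvd_level_quot_of_ne hΦ hS hθDprim hθDQ hℓ hℓd hℓp
  -- the character `p`-adic `L`-functions (Kubota–Leopoldt–Iwasawa, proved) and the facts C, D on `W`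
  obtain ⟨gC, hgC⟩ := exists_isCharacterLFunctionC_of_ne_one p φ'.primitiveCharacter S₀ hp2 hθC1
  obtain ⟨gD, hgD⟩ := exists_isCharacterLFunctionD_of_exists_ne p ψ'.primitiveCharacter S₀ hp2 hθDω hS₀
  obtain ⟨hCunit, hCcard⟩ := hCfact p κ φ'.conductor φ'.primitiveCharacter S₀ (lineSub Φ₀ hΦ).Sub hp2
    hθCprim hθCeven hθC1 hκ hS₀ hSm (natCard_sub_eq hΦ) hθCA gC hgC
  obtain ⟨hDunit, hDcard⟩ := hDfact p κ ψ'.conductor ψ'.primitiveCharacter S₀ (lineSub Φ₀ hΦ).Quot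
    hp2 hθDprim hθDodd hθDω hκ hS₀ hSd (natCard_quot_eq hΦ) hθDQ gD hgD
  -- the SAME `gC`, `gD` solve the interpolation problems at the product presentations
  have hS₀nat : ∀ v ∈ S₀, ¬ p ∣ Rat.HeightOneSpectrum.natGenerator v :=
    not_dvd_natGenerator_of_not_mem hS₀
  have hcopP : ∀ a : ℕ, ¬ p ∣ a → a.Coprime p := fun a ha ↦
    (Nat.coprime_comm.mp ((Nat.Prime.coprime_iff_not_dvd hpr).mpr ha))
  have hagreeC : ∀ a : ℕ, ¬ p ∣ a → (¬ ∃ v ∈ S₀, Rat.HeightOneSpectrum.natGenerator v ∣ a) →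
      φ' (a : ZMod (p * m)) = φ'.primitiveCharacter (a : ZMod φ'.conductor) := by
    intro a hpa hSa
    refine apply_natCast_eq_primitiveCharacter_of_coprime φ' (Nat.Coprime.mul_right (hcopP a hpa) ?_)
    by_contra hnc
    obtain ⟨ℓ, hℓ, hℓa, hℓm⟩ := Nat.Prime.not_coprime_iff_dvd.mp hnc
    have hℓp : ℓ ≠ p := fun h ↦ hpa (h ▸ hℓa)
    have hℓp' : ¬ ℓ ∣ p := fun h ↦ hℓp ((Nat.prime_dvd_prime_iff_eq hℓ hpr).mp h)
    have hℓc : ℓ ∣ φ'.conductor :=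
      dvd_conductor_mul_of_dvd χq hφprim hℓ hℓm hℓp' (dvd_mul_right p m) (dvd_mul_left m p)
    obtain ⟨v, hv, hvℓ⟩ := hSm ℓ hℓ hℓc hℓp
    exact hSa ⟨v, hv, by rw [natGenerator_eq_of_natCast_mem_asIdeal hℓ hvℓ]; exact hℓa⟩
  have hagreeD : ∀ a : ℕ, ¬ p ∣ a →
      ψ' (a : ZMod (d * p)) = ψ'.primitiveCharacter (a : ZMod ψ'.conductor) := by
    intro a hpa
    by_cases had : a.Coprime d
    · exact apply_natCast_eq_primitiveCharacter_of_coprime ψ' (Nat.Coprime.mul_right had (hcopP a hpa))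
    · obtain ⟨ℓ, hℓ, hℓa, hℓd⟩ := Nat.Prime.not_coprime_iff_dvd.mp had
      have hℓp : ℓ ≠ p := fun h ↦ hpa (h ▸ hℓa)
      have hℓp' : ¬ ℓ ∣ p := fun h ↦ hℓp ((Nat.prime_dvd_prime_iff_eq hℓ hpr).mp h)
      have hℓc : ℓ ∣ ψ'.conductor :=
        dvd_conductor_mul_of_dvd' χq hψprim hℓ hℓd hℓp' (dvd_mul_left p d) (dvd_mul_right d p)
      exact apply_natCast_eq_primitiveCharacter_of_dvd ψ' hℓ hℓa (Dvd.dvd.mul_right hℓd p) hℓc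
  have hgC' : IsCharacterLFunctionC p φ' S₀ gC :=
    (isCharacterLFunctionC_iff_of_apply_eq p S₀ φ' φ'.primitiveCharacter (Nat.pos_of_ne_zero (NeZero.ne _))
      (Nat.pos_of_ne_zero (NeZero.ne _)) hagreeC gC).mpr hgC
  have hgD' : IsCharacterLFunctionD p ψ' S₀ gD :=
    (isCharacterLFunctionD_iff_of_apply_eq p S₀ ψ' ψ'.primitiveCharacter (Nat.pos_of_ne_zero (NeZero.ne _))
      (Nat.pos_of_ne_zero (NeZero.ne _)) hS₀nat hagreeD gD).mpr hgD
  -- normalise the unit away: `b₀ = u⁻¹ b`, `ι b₀ = ϖ · B`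
  set b₀ : IwasawaAlgebra p := PowerSeries.C ((u⁻¹ : ℤ_[p]ˣ) : ℤ_[p]) * b with hb₀def
  have hb₀ : iwasawaToPowerSeries p b₀ = PowerSeries.C ((ϖ : ℚ) : ℚ_[p]) *
      padicLFunctionMinusBranch f ((unitRoot V p : ℤ_[p]) : ℚ_[p]) (p / 2) := by
    rw [hb₀def, map_mul, hb, ← mul_assoc]
    congr 1
    change PowerSeries.map _ (PowerSeries.C _) * _ = _
    rw [PowerSeries.map_C, ← map_mul]
    congr 1
    change (((u⁻¹ : ℤ_[p]ˣ) : ℤ_[p]) : ℚ_[p]) * _ = _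
    rw [← mul_assoc, ← PadicInt.coe_mul, Units.inv_mul, PadicInt.coe_one, one_mul]
  -- T312odd
  haveI := hm
  haveI := hdne
  obtain ⟨hiff, hordeq⟩ := h312 V p W f S₀ Φ₁ m φ d ψ hp2 hp4 ⟨hgood, hord⟩ ⟨C, hC⟩ hΦ₁r hram₁
    hodd₁ hf hφprim hψprim hφ0 hψ0 hS₀ hSV ϖ hϖ b₀ hb₀ gC gD hgC' hgD'
  -- conclusion: unit content
  have hCD : HasUnitContent (gC * gD) := by
    rw [hasUnitContent_iff_map_toZMod_ne_zero, map_mul]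
    exact mul_ne_zero ((hasUnitContent_iff_map_toZMod_ne_zero gC).mp hCunit)
      ((hasUnitContent_iff_map_toZMod_ne_zero gD).mp hDunit)
  have hu0 : IsUnit (PowerSeries.C ((u⁻¹ : ℤ_[p]ˣ) : ℤ_[p]) : IwasawaAlgebra p) :=
    (u⁻¹).isUnit.map PowerSeries.C
  have hb₀X : b₀ * eulerFactorProduct W p S₀ =
      PowerSeries.C ((u⁻¹ : ℤ_[p]ˣ) : ℤ_[p]) * (b * eulerFactorProduct W p S₀) := mul_assoc _ _ _
  have hunit : HasUnitContent (b * eulerFactorProduct W p S₀) := by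
    have h := hiff.mpr hCD
    rwa [hb₀X, hasUnitContent_unit_mul_iff hu0] at h
  refine ⟨hunit, ?_⟩
  -- conclusion: `ord_T` is additive
  have hord1 := hordeq hCD
  have hū : PadicInt.toZMod ((u⁻¹ : ℤ_[p]ˣ) : ℤ_[p]) ≠ 0 :=
    ((u⁻¹).isUnit.map (PadicInt.toZMod (p := p))).ne_zero
  have hordC : ∀ g : PowerSeries (ZMod p),
      (PowerSeries.C (PadicInt.toZMod ((u⁻¹ : ℤ_[p]ˣ) : ℤ_[p])) * g).order = g.order := fun g ↦ by
    rw [PowerSeries.order_mul, ← PowerSeries.monomial_zero_eq_C_apply,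
      PowerSeries.order_monomial_of_ne_zero 0 _ hū, Nat.cast_zero, zero_add]
  rw [hb₀X, map_mul, PowerSeries.map_C, hordC] at hord1
  have hCfin : (PowerSeries.map (PadicInt.toZMod (p := p)) gC).order ≠ ⊤ := fun h ↦
    (hasUnitContent_iff_map_toZMod_ne_zero gC).mp hCunit (PowerSeries.order_eq_top.mp h)
  have hDfin : (PowerSeries.map (PadicInt.toZMod (p := p)) gD).order ≠ ⊤ := fun h ↦
    (hasUnitContent_iff_map_toZMod_ne_zero gD).mp hDunit (PowerSeries.order_eq_top.mp h)
  change p ^ _ =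
    Nat.card (unramifiedOutside κ.kerSubgroup (lineSub Φ₀ hΦ).Sub p
        (↑S₀ : Set (HeightOneSpectrum (𝓞 ℚ)))) *
      Nat.card (unramifiedSelmer κ.kerSubgroup (lineSub Φ₀ hΦ).Quot p
        (↑S₀ : Set (HeightOneSpectrum (𝓞 ℚ))))
  rw [hord1, map_mul, PowerSeries.order_mul, ENat.toNat_add hCfin hDfin, pow_add, hCcard, hDcard]

end Summit.BirchSwinnertonDyer.BirchSwinnertonDyer.Theorems.AdditiveBranchIMCGreenbergVatsalResidualBranchOfPrintOdd

end
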